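import Summits.Ventures.DiscreteObjects.Hadamard.ConferenceGraph333InvolutionBound
import Summits.Ventures.DiscreteObjects.Hadamard.ConferenceGraph333InvolutionEdges

/-!
# Deviation sets of the `2`-orbits of an involution of srg(333,166,82,83) (kernel; Seidel-vector orbit-matrix tools)

Framing: lottery ticket; floor = certified bounds/negative ranges.  Cell pub-namedobj (venture DiscreteObjects),
target (H) = `H(668)`, hadamard gen 31.  Tools for the involution chapter of the automorphism census of
`srg(333,166,82,83) ⇔ symmetric C(334)` (gen 29: `f ≡ 1 (mod 4)`, `f ≤ 165`), at the level of an ABSTRACT Seidel matrix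
`S` (`S` symmetric, zero diagonal, `±1` off it, `S𝟙 = 0`, `S² = 333·I − J`) and an involution `τ` with `S_{τa,τb} = S_{ab}`.
For a moved vertex `x` (`x' = τx`) the *deviation vector* `g_x = S e_x + S e_{x'}` has `g_x(y) = 2S_{yx}` on the fixed set `F`,
`g_x(x) = g_x(x') = S_{xx'} = ε_x` (the *type* of `x`), and `g_x(y) ∈ {0, ±2}` on the other moved vertices; the *deviation set*
`Dev(x)` is the set of moved `y ∉ {x, x'}` with `S_{yx} = S_{yx'}` (joined to both or to neither of `x, x'`; `g_x(y) ≠ 0`).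
* `invol333_sum_split` — `Σ_V = Σ_F + (x) + (x') + Σ_{other moved}`; `invol333_even_card_of_closed` — a `τ`-closed set of
  moved vertices is even;
* `invol333_dev_norm` / `invol333_dev_cross` — `‖g_x‖² = 662`, `⟨g_x, g_z⟩ = −4` (`z ∉ {x, x'}`);
* **`invol333_dev_card`** — `4f + 4|Dev(x)| = 660`, i.e. `|Dev(x)| = 165 − f` (the orbit-matrix row identity 'every `2`-orbit is
  simply joined to exactly `83` others'; re-proves `f ≤ 165`);
* `invol333_fixed_col_sum` — `Σ_{y∈F} S_{yx} + ε_x + Σ_{y ∈ Dev(x)} S_{yx} = 0`;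
* `invol333_dev_symm` — `y ∈ Dev(x) ⇒ x, x' ∈ Dev(y)`;
* **`invol333_matched_common_dev`** — if `z ∉ {x, x'}` is MATCHED to `x` (`S_{zx} ≠ S_{zx'}`) and of the same type
  (`ε_z = ε_x`) then `Dev(x) ∩ Dev(z) ≠ ∅` (given `f ≡ 1 (mod 4)`): otherwise `⟨g_x, g_z⟩ = −4` reads `Σ_F S_{yx}S_{yz} = −1`,
  against `Σ_F S_{yx}S_{yz} ≡ −f + Σ_F S_{yx} + Σ_F S_{yz} ≡ −1 − 2ε_x (mod 4)`.
The bound `f ≤ 149` is drawn from these in `ConferenceGraph333InvolutionBound149`.  WORDS: structure of a HYPOTHETICAL object;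
method = orbit matrices (Behbahani–Lam 2011) in Seidel-vector form; instance and kernel proofs ours (PROVISIONAL).
No `sorry`, no new definitions.
-/

namespace Summit.Ventures.DiscreteObjects.Hadamard

open Finset

section invdevtools
variable {V : Type*} [Fintype V] [DecidableEq V]

omit [Fintype V] in
/-- A finset of moved points closed under an involution `τ` has even cardinality. -/
theorem invol333_even_card_of_closed (τ : Equiv.Perm V) (hτ : ∀ y, τ (τ y) = y) :
    ∀ (n : ℕ) (T : Finset V), T.card = n → (∀ y ∈ T, τ y ∈ T) → (∀ y ∈ T, τ y ≠ y) → 2 ∣ T.card := by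
  intro n
  induction n using Nat.strong_induction_on with
  | _ n ih =>
    intro T hTn hcl hfpf
    rcases T.eq_empty_or_nonempty with hT | ⟨y, hy⟩
    · simp [hT]
    · have hτy : τ y ∈ T.erase y := Finset.mem_erase.mpr ⟨hfpf y hy, hcl y hy⟩
      have hc1 : (T.erase y).card + 1 = T.card := Finset.card_erase_add_one hy
      have hc2 : ((T.erase y).erase (τ y)).card + 1 = (T.erase y).card := Finset.card_erase_add_one hτy
      have hmemT' : ∀ z, z ∈ (T.erase y).erase (τ y) ↔ z ∈ T ∧ z ≠ y ∧ z ≠ τ y := by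
        intro z
        rw [Finset.mem_erase, Finset.mem_erase]
        tauto
      have hcl' : ∀ z ∈ (T.erase y).erase (τ y), τ z ∈ (T.erase y).erase (τ y) := by
        intro z hz
        obtain ⟨hzT, hzy, hzτy⟩ := (hmemT' z).mp hz
        refine (hmemT' (τ z)).mpr ⟨hcl z hzT, fun h => hzτy ?_, fun h => hzy (τ.injective h)⟩
        rw [← h, hτ]
      have h2 : 2 ∣ ((T.erase y).erase (τ y)).card :=
        ih _ (by omega) _ rfl hcl' (fun z hz => hfpf z ((hmemT' z).mp hz).1)
      have hT2 : T.card = ((T.erase y).erase (τ y)).card + 2 := by omega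
      rw [hT2]
      exact h2.add (dvd_refl 2)

/-- `±1` values that differ sum to zero. -/
theorem pm_one_add_eq_zero {a b : ℤ} (ha : a = 1 ∨ a = -1) (hb : b = 1 ∨ b = -1) (hne : a ≠ b) : a + b = 0 := by
  rcases ha with rfl | rfl <;> rcases hb with rfl | rfl <;> omega

omit [Fintype V] [DecidableEq V] in
/-- Under an involution `τ` preserving `S`: `S (τ a) b = S a (τ b)`. -/
theorem invol333_S_swap (S : V → V → ℤ) (τ : Equiv.Perm V) (hτ : ∀ y, τ (τ y) = y)
    (hSτ : ∀ a b, S (τ a) (τ b) = S a b) (a b : V) : S (τ a) b = S a (τ b) := by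
  conv_lhs => rw [← hτ b]
  exact hSτ a (τ b)

/-- Splitting a sum over `V` at an involution `τ` and a moved point `x`:
`Σ_V G = Σ_F G + G x + G (τx) + Σ_{moved, ≠ x, τx} G`. -/
theorem invol333_sum_split (τ : Equiv.Perm V) (hτ : ∀ y, τ (τ y) = y) {x : V} (hx : τ x ≠ x) (G : V → ℤ) :
    ∑ y, G y = ∑ y ∈ univ.filter (fun y => τ y = y), G y + G x + G (τ x) +
      ∑ y ∈ univ.filter (fun y => τ y ≠ y ∧ y ≠ x ∧ y ≠ τ x), G y := by
  have h1 := Finset.sum_filter_add_sum_filter_not (univ : Finset V) (fun y => τ y = y) G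
  have hxM : x ∈ univ.filter (fun y => ¬ τ y = y) := Finset.mem_filter.mpr ⟨Finset.mem_univ _, hx⟩
  have hτxM : τ x ∈ (univ.filter (fun y => ¬ τ y = y)).erase x := by
    refine Finset.mem_erase.mpr ⟨fun h => hx h, Finset.mem_filter.mpr ⟨Finset.mem_univ _, ?_⟩⟩
    rw [hτ]; exact fun h => hx h.symm
  have h2 := Finset.add_sum_erase (univ.filter (fun y => ¬ τ y = y)) G hxM
  have h3 := Finset.add_sum_erase ((univ.filter (fun y => ¬ τ y = y)).erase x) G hτxM
  have hset : ((univ.filter (fun y => ¬ τ y = y)).erase x).erase (τ x) =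
      univ.filter (fun y => τ y ≠ y ∧ y ≠ x ∧ y ≠ τ x) := by
    ext y
    simp only [Finset.mem_erase, Finset.mem_filter, Finset.mem_univ, true_and]
    tauto
  rw [← h1, ← h2, ← h3, hset]
  ring

/-- Column identities of a Seidel matrix: `Σ_y S_ya S_yb = 333[a = b] − 1` and `Σ_y S_ya = 0`. -/
theorem seidel333_cols (S : V → V → ℤ) (hSs : ∀ x y, S y x = S x y) (hS1 : ∀ x, ∑ y, S x y = 0)
    (hSS : ∀ x y, ∑ z, S x z * S z y = 333 * (if x = y then 1 else 0) - 1) :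
    (∀ a b, ∑ y, S y a * S y b = 333 * (if a = b then 1 else 0) - 1) ∧ (∀ a, ∑ y, S y a = 0) := by
  refine ⟨fun a b => ?_, fun a => ?_⟩
  · rw [Finset.sum_congr rfl fun y _ => by rw [hSs a y]]
    exact hSS a b
  · rw [Finset.sum_congr rfl fun y _ => hSs a y]
    exact hS1 a

/-- **Norm of a deviation vector**: `Σ_y (S_yx + S_{y,τx})² = 662` for a moved `x`. -/
theorem invol333_dev_norm (S : V → V → ℤ) (hSs : ∀ x y, S y x = S x y) (hS1 : ∀ x, ∑ y, S x y = 0)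
    (hSS : ∀ x y, ∑ z, S x z * S z y = 333 * (if x = y then 1 else 0) - 1)
    (τ : Equiv.Perm V) {x : V} (hx : τ x ≠ x) : ∑ y, (S y x + S y (τ x)) ^ 2 = 662 := by
  obtain ⟨hcol, -⟩ := seidel333_cols S hSs hS1 hSS
  have e : ∀ y, (S y x + S y (τ x)) ^ 2 = S y x * S y x + 2 * (S y x * S y (τ x)) + S y (τ x) * S y (τ x) := by
    intro y; ring
  rw [Finset.sum_congr rfl fun y _ => e y, Finset.sum_add_distrib, Finset.sum_add_distrib, ← Finset.mul_sum,
    hcol, hcol, hcol, if_pos rfl, if_pos rfl, if_neg (fun h => hx h.symm)]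
  norm_num

/-- **Inner product of two deviation vectors**: `Σ_y (S_yx + S_{y,τx})(S_yz + S_{y,τz}) = −4` when `z ∉ {x, τx}`. -/
theorem invol333_dev_cross (S : V → V → ℤ) (hSs : ∀ x y, S y x = S x y) (hS1 : ∀ x, ∑ y, S x y = 0)
    (hSS : ∀ x y, ∑ z, S x z * S z y = 333 * (if x = y then 1 else 0) - 1)
    (τ : Equiv.Perm V) (hτ : ∀ y, τ (τ y) = y) {x z : V} (hzx : z ≠ x) (hzτx : z ≠ τ x) :
    ∑ y, (S y x + S y (τ x)) * (S y z + S y (τ z)) = -4 := by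
  obtain ⟨hcol, -⟩ := seidel333_cols S hSs hS1 hSS
  have e : ∀ y, (S y x + S y (τ x)) * (S y z + S y (τ z)) =
      S y x * S y z + S y x * S y (τ z) + S y (τ x) * S y z + S y (τ x) * S y (τ z) := by
    intro y; ring
  have h1 : x ≠ z := fun h => hzx h.symm
  have h2 : x ≠ τ z := fun h => hzτx (by rw [h, hτ])
  have h3 : τ x ≠ z := fun h => hzτx h.symm
  have h4 : τ x ≠ τ z := fun h => hzx (τ.injective h).symm
  rw [Finset.sum_congr rfl fun y _ => e y, Finset.sum_add_distrib, Finset.sum_add_distrib, Finset.sum_add_distrib,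
    hcol, hcol, hcol, hcol, if_neg h1, if_neg h2, if_neg h3, if_neg h4]
  norm_num

/-- The deviation set as an iterated filter. -/
theorem invol333_dev_filter (S : V → V → ℤ) (τ : Equiv.Perm V) (x : V) :
    (univ.filter fun y => (τ y ≠ y ∧ y ≠ x ∧ y ≠ τ x) ∧ S y x = S y (τ x)) =
      (univ.filter fun y => τ y ≠ y ∧ y ≠ x ∧ y ≠ τ x).filter (fun y => S y x = S y (τ x)) :=
  (Finset.filter_filter _ _ _).symm

/-- **Deviation sets have `165 − f` elements**: for a moved `x`, `4f + 4·|Dev(x)| = 660` where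
`Dev(x) = {y : τy ≠ y, y ≠ x, y ≠ τx, S_yx = S_{y,τx}}`. -/
theorem invol333_dev_card (S : V → V → ℤ) (hSd : ∀ x, S x x = 0) (hSo : ∀ x y, x ≠ y → S x y = 1 ∨ S x y = -1)
    (hSs : ∀ x y, S y x = S x y) (hS1 : ∀ x, ∑ y, S x y = 0)
    (hSS : ∀ x y, ∑ z, S x z * S z y = 333 * (if x = y then 1 else 0) - 1)
    (τ : Equiv.Perm V) (hτ : ∀ y, τ (τ y) = y) (hSτ : ∀ a b, S (τ a) (τ b) = S a b) {x : V} (hx : τ x ≠ x) :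
    4 * ((univ.filter fun y => τ y = y).card : ℤ) +
      4 * ((univ.filter fun y => (τ y ≠ y ∧ y ≠ x ∧ y ≠ τ x) ∧ S y x = S y (τ x)).card : ℤ) = 660 := by
  have hnorm := invol333_dev_norm S hSs hS1 hSS τ hx
  rw [invol333_sum_split τ hτ hx] at hnorm
  -- fixed part: each term is 4
  have hF : ∑ y ∈ univ.filter (fun y => τ y = y), (S y x + S y (τ x)) ^ 2 =
      4 * ((univ.filter fun y => τ y = y).card : ℤ) := by
    have h4 : ∀ y ∈ univ.filter (fun y => τ y = y), (S y x + S y (τ x)) ^ 2 = 4 := by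
      intro y hy
      have hyf : τ y = y := (Finset.mem_filter.mp hy).2
      have h1 : S y (τ x) = S y x := by rw [← hSτ y x, hyf]
      have hyx : y ≠ x := fun h => hx (by rw [← h, hyf])
      rw [h1]
      rcases hSo y x hyx with h | h <;> rw [h] <;> norm_num
    rw [Finset.sum_congr rfl h4, Finset.sum_const, nsmul_eq_mul]
    ring
  -- the pair x, τx: 1 each
  have hxx : (S x x + S x (τ x)) ^ 2 = 1 := by
    rw [hSd, zero_add]
    rcases hSo x (τ x) (fun h => hx h.symm) with h | h <;> rw [h] <;> norm_num
  have hτxx : (S (τ x) x + S (τ x) (τ x)) ^ 2 = 1 := by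
    rw [hSd, add_zero]
    rcases hSo (τ x) x hx with h | h <;> rw [h] <;> norm_num
  -- other moved vertices: 4 on Dev(x), 0 elsewhere
  have hO : ∑ y ∈ univ.filter (fun y => τ y ≠ y ∧ y ≠ x ∧ y ≠ τ x), (S y x + S y (τ x)) ^ 2 =
      4 * ((univ.filter fun y => (τ y ≠ y ∧ y ≠ x ∧ y ≠ τ x) ∧ S y x = S y (τ x)).card : ℤ) := by
    rw [invol333_dev_filter, Finset.card_filter, Nat.cast_sum, Finset.mul_sum]
    refine Finset.sum_congr rfl fun y hy => ?_
    obtain ⟨-, hyx, hyτx⟩ := (Finset.mem_filter.mp hy).2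
    rcases hSo y x hyx with h1 | h1 <;> rcases hSo y (τ x) hyτx with h2 | h2 <;> simp [h1, h2]
  rw [hF, hxx, hτxx, hO] at hnorm
  linarith

/-- **Column sum over the fixed set**: for a moved `x`, `Σ_{y ∈ F} S_yx + ε_x + Σ_{y ∈ Dev(x)} S_yx = 0` (`ε_x = S_{x,τx}`). -/
theorem invol333_fixed_col_sum (S : V → V → ℤ) (hSd : ∀ x, S x x = 0)
    (hSo : ∀ x y, x ≠ y → S x y = 1 ∨ S x y = -1) (hSs : ∀ x y, S y x = S x y) (hS1 : ∀ x, ∑ y, S x y = 0)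
    (hSS : ∀ x y, ∑ z, S x z * S z y = 333 * (if x = y then 1 else 0) - 1)
    (τ : Equiv.Perm V) (hτ : ∀ y, τ (τ y) = y) (hSτ : ∀ a b, S (τ a) (τ b) = S a b) {x : V} (hx : τ x ≠ x) :
    ∑ y ∈ univ.filter (fun y => τ y = y), S y x + S x (τ x) +
      ∑ y ∈ univ.filter (fun y => (τ y ≠ y ∧ y ≠ x ∧ y ≠ τ x) ∧ S y x = S y (τ x)), S y x = 0 := by
  obtain ⟨-, hcol0⟩ := seidel333_cols S hSs hS1 hSS
  have hlin : ∑ y, (S y x + S y (τ x)) = 0 := by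
    rw [Finset.sum_add_distrib, hcol0, hcol0, add_zero]
  rw [invol333_sum_split τ hτ hx] at hlin
  have hF : ∑ y ∈ univ.filter (fun y => τ y = y), (S y x + S y (τ x)) =
      2 * ∑ y ∈ univ.filter (fun y => τ y = y), S y x := by
    rw [Finset.mul_sum]
    refine Finset.sum_congr rfl fun y hy => ?_
    have hyf : τ y = y := (Finset.mem_filter.mp hy).2
    have h1 : S y (τ x) = S y x := by rw [← hSτ y x, hyf]
    rw [h1]; ring
  have hxx : S x x + S x (τ x) = S x (τ x) := by rw [hSd, zero_add]
  have hτxx : S (τ x) x + S (τ x) (τ x) = S x (τ x) := by rw [hSd, add_zero, hSs]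
  have hO : ∑ y ∈ univ.filter (fun y => τ y ≠ y ∧ y ≠ x ∧ y ≠ τ x), (S y x + S y (τ x)) =
      2 * ∑ y ∈ univ.filter (fun y => (τ y ≠ y ∧ y ≠ x ∧ y ≠ τ x) ∧ S y x = S y (τ x)), S y x := by
    conv_rhs => rw [invol333_dev_filter, Finset.sum_filter]
    rw [Finset.mul_sum]
    refine Finset.sum_congr rfl fun y hy => ?_
    obtain ⟨-, hyx, hyτx⟩ := (Finset.mem_filter.mp hy).2
    rcases hSo y x hyx with h1 | h1 <;> rcases hSo y (τ x) hyτx with h2 | h2 <;> simp [h1, h2]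
  rw [hF, hxx, hτxx, hO] at hlin
  linarith

/-- Membership in a deviation set, unfolded. -/
theorem invol333_mem_dev_iff (S : V → V → ℤ) (τ : Equiv.Perm V) (x y : V) :
    y ∈ univ.filter (fun y => (τ y ≠ y ∧ y ≠ x ∧ y ≠ τ x) ∧ S y x = S y (τ x)) ↔
      (τ y ≠ y ∧ y ≠ x ∧ y ≠ τ x) ∧ S y x = S y (τ x) := by
  simp only [Finset.mem_filter, Finset.mem_univ, true_and]

omit [Fintype V] [DecidableEq V] in
/-- Deviation is symmetric and `τ`-closed at the level of entries: `S_yx = S_{y,τx} ↔ S_xy = S_{x,τy}`, and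
`S_{τy,x} = S_{τy,τx} ↔ S_yx = S_{y,τx}`. -/
theorem invol333_dev_symm_aux (S : V → V → ℤ) (hSs : ∀ x y, S y x = S x y) (τ : Equiv.Perm V)
    (hτ : ∀ y, τ (τ y) = y) (hSτ : ∀ a b, S (τ a) (τ b) = S a b) (x y : V) :
    (S y x = S y (τ x) ↔ S x y = S x (τ y)) ∧ (S (τ y) x = S (τ y) (τ x) ↔ S y x = S y (τ x)) := by
  have e1 : S y (τ x) = S (τ y) x := (invol333_S_swap S τ hτ hSτ y x).symm
  have e2 : S x (τ y) = S (τ y) x := hSs (τ y) x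
  have e3 : S (τ y) (τ x) = S y x := hSτ y x
  constructor
  · rw [hSs x y, e2, e1]
  · rw [e3, ← e1]; exact eq_comm

/-- For moved `x` and `y ∈ Dev(x)`: `x ∈ Dev(y)` and `τx ∈ Dev(y)`. -/
theorem invol333_dev_symm (S : V → V → ℤ) (hSs : ∀ x y, S y x = S x y) (τ : Equiv.Perm V)
    (hτ : ∀ y, τ (τ y) = y) (hSτ : ∀ a b, S (τ a) (τ b) = S a b) {x y : V} (hx : τ x ≠ x)
    (hy : y ∈ univ.filter (fun y => (τ y ≠ y ∧ y ≠ x ∧ y ≠ τ x) ∧ S y x = S y (τ x))) :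
    x ∈ univ.filter (fun w => (τ w ≠ w ∧ w ≠ y ∧ w ≠ τ y) ∧ S w y = S w (τ y)) ∧
      τ x ∈ univ.filter (fun w => (τ w ≠ w ∧ w ≠ y ∧ w ≠ τ y) ∧ S w y = S w (τ y)) := by
  obtain ⟨⟨hyy, hyx, hyτx⟩, hdev⟩ := (invol333_mem_dev_iff S τ x y).mp hy
  have h1 : S x y = S x (τ y) := ((invol333_dev_symm_aux S hSs τ hτ hSτ x y).1).mp hdev
  refine ⟨(invol333_mem_dev_iff S τ y x).mpr ⟨⟨hx, fun h => hyx h.symm, fun h => hyτx (by rw [h, hτ])⟩, h1⟩,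
    (invol333_mem_dev_iff S τ y (τ x)).mpr ⟨⟨by rw [hτ]; exact fun h => hx h.symm, fun h => hyτx h.symm,
      fun h => hyx (τ.injective h).symm⟩, ?_⟩⟩
  rw [invol333_S_swap S τ hτ hSτ x y, hSτ x y, ← h1]

/-- For moved `y ∈ Dev(u)`, also `τy ∈ Dev(u)`. -/
theorem invol333_dev_tau_mem (S : V → V → ℤ) (hSs : ∀ x y, S y x = S x y) (τ : Equiv.Perm V)
    (hτ : ∀ y, τ (τ y) = y) (hSτ : ∀ a b, S (τ a) (τ b) = S a b) {u y : V}
    (hy : y ∈ univ.filter (fun y => (τ y ≠ y ∧ y ≠ u ∧ y ≠ τ u) ∧ S y u = S y (τ u))) :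
    τ y ∈ univ.filter (fun y => (τ y ≠ y ∧ y ≠ u ∧ y ≠ τ u) ∧ S y u = S y (τ u)) := by
  obtain ⟨⟨hyy, hyu, hyτu⟩, hdev⟩ := (invol333_mem_dev_iff S τ u y).mp hy
  exact (invol333_mem_dev_iff S τ u (τ y)).mpr ⟨⟨by rw [hτ]; exact fun h => hyy h.symm,
    fun h => hyτu (by rw [← h, hτ]), fun h => hyu (τ.injective h)⟩,
    ((invol333_dev_symm_aux S hSs τ hτ hSτ u y).2).mpr hdev⟩

/-- **`Σ_{y∈F} S_yu ≡ −ε_u (mod 4)`** for a moved `u`, given `f ≡ 1 (mod 4)`: from the column sum, `|Dev(u)| = 165 − f ≡ 0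
(mod 4)` and the evenness of the `τ`-closed set `{y ∈ Dev(u) : S_yu = −1}`. -/
theorem invol333_fixed_col_sum_mod_four (S : V → V → ℤ) (hSd : ∀ x, S x x = 0)
    (hSo : ∀ x y, x ≠ y → S x y = 1 ∨ S x y = -1) (hSs : ∀ x y, S y x = S x y) (hS1 : ∀ x, ∑ y, S x y = 0)
    (hSS : ∀ x y, ∑ z, S x z * S z y = 333 * (if x = y then 1 else 0) - 1)
    (τ : Equiv.Perm V) (hτ : ∀ y, τ (τ y) = y) (hSτ : ∀ a b, S (τ a) (τ b) = S a b)
    (hf4 : (univ.filter fun y => τ y = y).card % 4 = 1) {u : V} (hu : τ u ≠ u) :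
    (4 : ℤ) ∣ ∑ y ∈ univ.filter (fun y => τ y = y), S y u + S u (τ u) := by
  have hcs := invol333_fixed_col_sum S hSd hSo hSs hS1 hSS τ hτ hSτ hu
  have hcard := invol333_dev_card S hSd hSo hSs hS1 hSS τ hτ hSτ hu
  set Du := univ.filter (fun y => (τ y ≠ y ∧ y ≠ u ∧ y ≠ τ u) ∧ S y u = S y (τ u)) with hDu
  set Dm := Du.filter (fun y => S y u = -1) with hDm
  -- Σ_{Du} S y u = |Du| − 2 |Dm|
  have hsumDu : ∑ y ∈ Du, S y u = (Du.card : ℤ) - 2 * (Dm.card : ℤ) := by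
    have e : ∀ y ∈ Du, S y u = 1 - 2 * (if S y u = -1 then 1 else 0) := by
      intro y hy
      have hyu : y ≠ u := ((invol333_mem_dev_iff S τ u y).mp hy).1.2.1
      rcases hSo y u hyu with h | h <;> simp [h]
    rw [Finset.sum_congr rfl e, Finset.sum_sub_distrib, Finset.sum_const, nsmul_eq_mul, mul_one, ← Finset.mul_sum,
      Finset.sum_boole, hDm]
  -- |Dm| is even
  have hDm2 : 2 ∣ Dm.card := by
    refine invol333_even_card_of_closed τ hτ Dm.card Dm rfl (fun y hy => ?_) (fun y hy => ?_)
    · rw [hDm, Finset.mem_filter] at hy ⊢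
      obtain ⟨hyDu, hym⟩ := hy
      refine ⟨invol333_dev_tau_mem S hSs τ hτ hSτ hyDu, ?_⟩
      rw [invol333_S_swap S τ hτ hSτ y u, ← ((invol333_mem_dev_iff S τ u y).mp hyDu).2, hym]
    · rw [hDm, Finset.mem_filter] at hy
      exact ((invol333_mem_dev_iff S τ u y).mp hy.1).1.1
  have hf4' : ((univ.filter fun y => τ y = y).card : ℤ) % 4 = 1 := by exact_mod_cast hf4
  rw [hsumDu] at hcs
  obtain ⟨m, hm⟩ := hDm2
  have hm' : (Dm.card : ℤ) = 2 * m := by exact_mod_cast hm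
  rw [hm'] at hcs
  have hDu4 : (4 : ℤ) ∣ (Du.card : ℤ) := by
    have : (Du.card : ℤ) = 165 - ((univ.filter fun y => τ y = y).card : ℤ) := by linarith
    rw [this]; omega
  obtain ⟨q, hq⟩ := hDu4
  rw [hq] at hcs
  exact ⟨m - q, by linarith⟩

/-- **Matched pairs of the same type have a common deviation vertex.**  For moved `x, z` with `z ∉ {x, τx}`,
`S_{zx} ≠ S_{z,τx}` (matched) and `S_{z,τz} = S_{x,τx}` (same type), some `y` lies in `Dev(x) ∩ Dev(z)` — given
`f ≡ 1 (mod 4)`. -/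
theorem invol333_matched_common_dev (S : V → V → ℤ) (hSd : ∀ x, S x x = 0)
    (hSo : ∀ x y, x ≠ y → S x y = 1 ∨ S x y = -1) (hSs : ∀ x y, S y x = S x y) (hS1 : ∀ x, ∑ y, S x y = 0)
    (hSS : ∀ x y, ∑ z, S x z * S z y = 333 * (if x = y then 1 else 0) - 1)
    (τ : Equiv.Perm V) (hτ : ∀ y, τ (τ y) = y) (hSτ : ∀ a b, S (τ a) (τ b) = S a b)
    (hf4 : (univ.filter fun y => τ y = y).card % 4 = 1)
    {x z : V} (hx : τ x ≠ x) (hz : τ z ≠ z) (hzx : z ≠ x) (hzτx : z ≠ τ x)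
    (hmatch : S z x ≠ S z (τ x)) (htype : S z (τ z) = S x (τ x)) :
    ∃ y, y ∈ univ.filter (fun y => (τ y ≠ y ∧ y ≠ x ∧ y ≠ τ x) ∧ S y x = S y (τ x)) ∧
      y ∈ univ.filter (fun y => (τ y ≠ y ∧ y ≠ z ∧ y ≠ τ z) ∧ S y z = S y (τ z)) := by
  by_contra hnone
  push Not at hnone
  -- (1) the cross identity, split at x
  have hcross := invol333_dev_cross S hSs hS1 hSS τ hτ hzx hzτx
  rw [invol333_sum_split τ hτ hx] at hcross
  have hFpart : ∑ y ∈ univ.filter (fun y => τ y = y), (S y x + S y (τ x)) * (S y z + S y (τ z)) =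
      4 * ∑ y ∈ univ.filter (fun y => τ y = y), S y x * S y z := by
    rw [Finset.mul_sum]
    refine Finset.sum_congr rfl fun y hy => ?_
    have hyf : τ y = y := (Finset.mem_filter.mp hy).2
    rw [show S y (τ x) = S y x by rw [← hSτ y x, hyf], show S y (τ z) = S y z by rw [← hSτ y z, hyf]]
    ring
  have sw_xz : S x (τ z) = S z (τ x) := by rw [← invol333_S_swap S τ hτ hSτ x z, hSs]
  have sw_τxτz : S (τ x) (τ z) = S z x := by rw [hSτ, hSs]
  have sw_τzx : S (τ z) x = S z (τ x) := invol333_S_swap S τ hτ hSτ z x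
  have hm0 : S z x + S z (τ x) = 0 := pm_one_add_eq_zero (hSo z x hzx) (hSo z (τ x) hzτx) hmatch
  have hx0 : (S x x + S x (τ x)) * (S x z + S x (τ z)) = 0 := by
    rw [hSs z x, sw_xz, hm0, mul_zero]
  have hτx0 : (S (τ x) x + S (τ x) (τ x)) * (S (τ x) z + S (τ x) (τ z)) = 0 := by
    rw [hSs z (τ x), sw_τxτz, add_comm (S z (τ x)), hm0, mul_zero]
  have hO : ∑ y ∈ univ.filter (fun y => τ y ≠ y ∧ y ≠ x ∧ y ≠ τ x),
      (S y x + S y (τ x)) * (S y z + S y (τ z)) = 0 := by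
    refine Finset.sum_eq_zero fun y hy => ?_
    obtain ⟨hyy, hyx, hyτx⟩ := (Finset.mem_filter.mp hy).2
    by_cases hyz : y = z
    · rw [hyz, hm0, zero_mul]
    by_cases hyτz : y = τ z
    · rw [hyτz, sw_τzx, hSτ z x, add_comm (S z (τ x)), hm0, zero_mul]
    by_cases hdx : S y x = S y (τ x)
    · have hyDx := (invol333_mem_dev_iff S τ x y).mpr ⟨⟨hyy, hyx, hyτx⟩, hdx⟩
      have hndz : S y z ≠ S y (τ z) := fun hdz =>
        hnone y hyDx ((invol333_mem_dev_iff S τ z y).mpr ⟨⟨hyy, hyz, hyτz⟩, hdz⟩)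
      rw [pm_one_add_eq_zero (hSo y z hyz) (hSo y (τ z) hyτz) hndz, mul_zero]
    · rw [pm_one_add_eq_zero (hSo y x hyx) (hSo y (τ x) hyτx) hdx, zero_mul]
  rw [hFpart, hx0, hτx0, hO] at hcross
  have hΦ : ∑ y ∈ univ.filter (fun y => τ y = y), S y x * S y z = -1 := by linarith
  -- (2) Φ ≡ −f + σ_x + σ_z (mod 4)
  have hΦ4 : (4 : ℤ) ∣ ∑ y ∈ univ.filter (fun y => τ y = y), S y x * S y z +
      (univ.filter fun y => τ y = y).card - ∑ y ∈ univ.filter (fun y => τ y = y), S y x -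
      ∑ y ∈ univ.filter (fun y => τ y = y), S y z := by
    have e : ∑ y ∈ univ.filter (fun y => τ y = y), S y x * S y z + (univ.filter fun y => τ y = y).card -
        ∑ y ∈ univ.filter (fun y => τ y = y), S y x - ∑ y ∈ univ.filter (fun y => τ y = y), S y z =
        ∑ y ∈ univ.filter (fun y => τ y = y), (1 - S y x) * (1 - S y z) := by
      rw [Finset.sum_congr rfl fun y _ =>
          show (1 - S y x) * (1 - S y z) = S y x * S y z + 1 - S y x - S y z by ring,
        Finset.sum_sub_distrib, Finset.sum_sub_distrib, Finset.sum_add_distrib, Finset.sum_const, nsmul_eq_mul,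
        mul_one]
    rw [e]
    refine Finset.dvd_sum fun y hy => ?_
    have hyf : τ y = y := (Finset.mem_filter.mp hy).2
    have hyx : y ≠ x := fun h => hx (by rw [← h, hyf])
    have hyz : y ≠ z := fun h => hz (by rw [← h, hyf])
    rcases hSo y x hyx with h1 | h1 <;> rcases hSo y z hyz with h2 | h2 <;> simp [h1, h2]
  -- (3) σ ≡ −ε (mod 4) for x and z, and the contradiction
  have hσx := invol333_fixed_col_sum_mod_four S hSd hSo hSs hS1 hSS τ hτ hSτ hf4 hx
  have hσz := invol333_fixed_col_sum_mod_four S hSd hSo hSs hS1 hSS τ hτ hSτ hf4 hz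
  have hf4' : ((univ.filter fun y => τ y = y).card : ℤ) % 4 = 1 := by exact_mod_cast hf4
  rw [hΦ] at hΦ4
  rw [htype] at hσz
  rcases hSo x (τ x) (fun h => hx h.symm) with he | he <;> rw [he] at hσx hσz <;> omega

end invdevtools

end Summit.Ventures.DiscreteObjects.Hadamard
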